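import Literature.NumberTheory.ComplexMultiplication.CMTypeRankIrreducibleSlot
import HarnessLib

/-!
# POINTWISE partial conjugations: the exact criterion for two slots of a family of CM types to have no common
# constituent

COR-CM (cell `pub-hodgecm2`, binder seat `b16` gen 48, count-neutral claim PTCONJ, file F1 — the abstract `G`-set
level; theorems only, no definition, no named fact, no `sorry`).  NEW as stated, hence under `Summits/`.  HONEST
FRAMING: a representation-theoretic lemma about families of CM types; `HC_CM` is neither used nor asserted.

SETTING (the tree's `Literature.NumberTheory.ComplexMultiplication.CMTypeRankCommonConstituent`): a group `G` acting
slot by slot on `⊔_i E_i` (Deligne's `Hom(∏_i K_i, ℂ)`), a conjugation `ρ ∈ G` (central, fixed-point free involution on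
each slot), CM types `Φ_i ⊆ E_i` for `ρ`, their antisymmetric spans `U(Φ_i) ≤ Anti(E_i)` (the `ρ`-odd weights).  Two slots
`i, j` have NO COMMON CONSTITUENT when every `G`-stable `P ≤ U(Φ_i)` carrying a linear `T : ℚ^{E_i} → ℚ^{E_j}`,
equivariant and injective on `P`, with `T(P) ≤ U(Φ_j)`, is zero; pairwise absence of common constituents gives the rank
additivity `U(Σ) = ⊕_i U(Φ_i)` (`Hg(∏_i A_i) = ∏_i Hg(A_i)`, `map_slotExt_antiSpan_le_of_pairwise`).  The sufficient
conditions in the tree form a chain of ever weaker hypotheses on ONE element `σ ∈ G`: slotwise independence ⊂ a partial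
conjugation (`σ = ρ` on `E_i`, `σ = 1` on `E_j`, `pairwise_of_partialConj`) ⊂ ONE CONJUGATE (`σ = ρ` on `E_i`, `σ` fixes
ONE point `y₀` of the transitive slot `E_j`, `pairwise_of_rho_on_slot_of_smul_eq`).  This file reaches the end of that
chain and shows that it IS the end:

> **Theorem** (`pairwise_of_pointwiseConj`; converse in the sequel `PointwiseConjugationSlotsConverse`).  Suppose that
> for EVERY PAIR `(x, y) ∈ E_i × E_j` some `g ∈ G` (depending on the pair) has `g x = ρ x` and `g y = y` — a POINTWISE
> partial conjugation.  Then the slots `i`, `j` have no common constituent, in both orders, for all CM types.  Conversely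
> (sequel), if some pair `(x₀, y₀)` admits no such `g`, then the full odd weights `Anti(E_i)`, `Anti(E_j)` DO have a
> common constituent — so for NONDEGENERATE types (`U = Anti`) the criterion is an equivalence.

By transitivity on `E_j` one base point suffices (`pointwiseConj_of_basePoint`: `∀ x ∃ g, g x = ρ x ∧ g y₀ = y₀`), and the
condition is SYMMETRIC in the two slots (`pointwiseConj_symm`: `g ↦ ρ g⁻¹`).  In Galois terms (`E_i = G/H_i`): the
condition at `(x, y)` reads `ρ ∈ H_y H_x`, i.e. the `G`-orbit of `(x, y)` in `E_i × E_j` is stable under `ρ × 1`; by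
Mackey / Frobenius the equivariant maps `ℚ^{E_i} → ℚ^{E_j}` are spanned by the orbit operators `T_O`, and `T_O`
compressed to the odd weights is `½(T_O − T_{(ρ×1)O})`, non-zero iff `(ρ × 1)O ≠ O` — whence the equivalence (and
`dim Hom_G(Anti E_i, Anti E_j) = ½ · #{O : (ρ×1)O ≠ O}`, not needed here).

PROOF (finite-dimensional linear algebra over `ℚ`, no Maschke theorem, `G` not assumed finite;
`apply_eq_zero_of_pointwiseConj`): the dot product on `ℚ^{E_i}` is `G`-invariant, so a stable `P` has the stable
complement `P^⊥` and the projection `π` onto `P` along `P^⊥` is EQUIVARIANT (`exists_equivariant_proj`); `T' = T ∘ π` is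
equivariant on all of `ℚ^{E_i}`, its kernel `k(x, y) = T'(δ_x)(y)` satisfies `k(gx, gy) = k(x, y)`, hence
`k(ρx, y) = k(gx, gy) = k(x, y)` for the pointwise `g`; for an odd `f ∈ P`,
`(Tf)(y) = Σ_x f(x) k(x, y) = Σ_x f(ρx) k(ρx, y) = −Σ_x f(x) k(x, y)`, so `T f = 0`, and injectivity gives `P = 0`.

## References

* [Gordon1999HodgeAVSurvey] B. B. Gordon, *A survey of the Hodge conjecture for abelian varieties*, §3 Theorem (Imai,
  Murty) with proof ("there is some `σ ∈ 𝒢` that acts as `+1` on `X(K^×_{1,1})` and `−1` on the other components"); 7.5.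
* [Serre1977] J.-P. Serre, *Linear Representations of Finite Groups*, GTM 42, §7.3–7.4 (induced representations,
  Frobenius reciprocity, Mackey's criterion via double cosets).
* [Deligne1982HodgeCycles] P. Deligne, *Hodge cycles on abelian varieties*, LNM 900 (1982), I Ex. 3.7 (the character
  module of the Mumford–Tate group of a CM abelian variety as a Galois module generated by the type).

Provenance: Literature home (family `hodge`, namespace `Literature.NumberTheory.ComplexMultiplication.PointwiseConjugation`) of the Summits-side `CorCM/PointwiseConjugationSlots` (cell `pub-hodgecm2`, COR-CM; all its imports are `Literature/` and Mathlib), which `Literature/` may not import; theorems only, no named fact, no definition. Nothing here bears on `HC_CM`. Lane `lit-hodgefound` (Layer A3: CM types, their Kubota ranks and Galois combinatorics), seat p20.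
-/

set_option autoImplicit false

noncomputable section

open scoped BigOperators

namespace Literature.NumberTheory.ComplexMultiplication.PointwiseConjugation

namespace PointwiseConj

open Literature.NumberTheory.ComplexMultiplication

variable {G : Type*} [Group G]

/-! ### §0 Tools: the invariant dot product and the EQUIVARIANT orthogonal projection onto a stable subspace -/

section Tools

variable {X : Type*} [MulAction G X] [Fintype X]

/-- The dot product on `ℚ^X` is invariant under permutations of `X` by `G`. [cite: Gordon1999HodgeAVSurvey, §3 Theorem (proof)] -/
private theorem dotProduct_comp_smul (f f' : X → ℚ) (g : G) :
    (fun x => f (g • x)) ⬝ᵥ (fun x => f' (g • x)) = f ⬝ᵥ f' :=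
  Fintype.sum_equiv (MulAction.toPerm g) _ _ fun _ => rfl

/-- The orthogonal complement of a `G`-stable subspace of `ℚ^X` is `G`-stable. [cite: Gordon1999HodgeAVSurvey, §3 Theorem (proof)] -/
theorem comp_smul_mem_orthogonal {W : Submodule ℚ (X → ℚ)}
    (hW : ∀ g : G, ∀ f ∈ W, (fun x => f (g • x)) ∈ W)
    {m : X → ℚ} (hm : m ∈ LinearMap.BilinForm.orthogonal (dotProductBilin ℚ ℚ) W) (g : G) :
    (fun x => m (g • x)) ∈ LinearMap.BilinForm.orthogonal (dotProductBilin ℚ ℚ) W := by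
  rw [LinearMap.BilinForm.mem_orthogonal_iff] at hm ⊢
  intro n hn
  have h1 := hm (fun x => n (g⁻¹ • x)) (hW g⁻¹ n hn)
  change _ ⬝ᵥ _ = 0 at h1
  change n ⬝ᵥ _ = 0
  rw [← dotProduct_comp_smul (fun x => n (g⁻¹ • x)) m g] at h1
  simpa only [inv_smul_smul] using h1

/-- The dot product on `ℚ^X` is reflexive. [cite: Gordon1999HodgeAVSurvey, §3 Theorem (proof)] -/
private theorem isRefl_dotProductBilin : (dotProductBilin ℚ ℚ : LinearMap.BilinForm ℚ (X → ℚ)).IsRefl := by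
  intro x y h
  change x ⬝ᵥ y = 0 at h
  change y ⬝ᵥ x = 0
  rwa [dotProduct_comm]

/-- The dot product restricted to any subspace of `ℚ^X` is non-degenerate (it is positive definite). [cite: Gordon1999HodgeAVSurvey, §3 Theorem (proof)] -/
private theorem restrict_dotProductBilin_nondegenerate (W : Submodule ℚ (X → ℚ)) :
    (LinearMap.BilinForm.restrict (dotProductBilin ℚ ℚ : LinearMap.BilinForm ℚ (X → ℚ)) W).Nondegenerate := by
  refine ⟨fun m hm => ?_, fun m hm => ?_⟩
  all_goals
    have h := hm m
    rw [LinearMap.BilinForm.restrict_apply] at h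
    change (m : X → ℚ) ⬝ᵥ (m : X → ℚ) = 0 at h
    exact Subtype.ext (dotProduct_self_eq_zero.1 h)

/-- Every subspace of `ℚ^X` is complemented by its orthogonal complement for the dot product. [cite: Gordon1999HodgeAVSurvey, §3 Theorem (proof)] -/
theorem isCompl_orthogonal (W : Submodule ℚ (X → ℚ)) :
    IsCompl W (LinearMap.BilinForm.orthogonal (dotProductBilin ℚ ℚ) W) :=
  LinearMap.BilinForm.isCompl_orthogonal_of_restrict_nondegenerate isRefl_dotProductBilin
    (restrict_dotProductBilin_nondegenerate W)

/-- **The orthogonal projection onto a `G`-stable subspace is equivariant.**  For a `G`-stable `P ≤ ℚ^X` there is a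
linear `π : ℚ^X → ℚ^X` with values in `P`, the identity on `P`, commuting with precomposition by every `g ∈ G` (the
projection along the stable complement `P^⊥`). [cite: Serre1977, §1.3 Thm. 1 (proof)] -/
theorem exists_equivariant_proj (P : Submodule ℚ (X → ℚ)) (hP : ∀ g : G, ∀ f ∈ P, (fun x => f (g • x)) ∈ P) :
    ∃ π : (X → ℚ) →ₗ[ℚ] (X → ℚ), (∀ f, π f ∈ P) ∧ (∀ f ∈ P, π f = f) ∧
      ∀ (g : G) (f : X → ℚ), π (fun x => f (g • x)) = fun x => π f (g • x) := by
  set Q : Submodule ℚ (X → ℚ) := LinearMap.BilinForm.orthogonal (dotProductBilin ℚ ℚ) P with hQ_def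
  have hc : IsCompl P Q := isCompl_orthogonal P
  have hQ : ∀ g : G, ∀ f ∈ Q, (fun x => f (g • x)) ∈ Q := fun g f hf => comp_smul_mem_orthogonal hP hf g
  refine ⟨P.projection Q hc, fun f => Submodule.projection_apply_mem hc f,
    fun f hf => Submodule.projection_apply_of_mem_left hc hf, fun g f => ?_⟩
  -- decompose `f = p + (f - p)`, `p ∈ P`, `f - p ∈ Q`; both pieces stay in their subspace under `g`
  set p : X → ℚ := P.projection Q hc f with hp_def
  have hpP : p ∈ P := Submodule.projection_apply_mem hc f
  have hqQ : f - p ∈ Q := Submodule.sub_projection_mem hc f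
  have hsplit : (fun x => f (g • x)) = (fun x => p (g • x)) + fun x => (f - p) (g • x) := by
    funext x
    simp only [Pi.add_apply, Pi.sub_apply]
    ring
  rw [hsplit, map_add, Submodule.projection_apply_of_mem_left hc (hP g p hpP),
    Submodule.projection_apply_of_mem_right hc (hQ g _ hqQ), add_zero]

end Tools

/-! ### §1 The pointwise condition: symmetry in the two slots, reduction to one base point, the old hypotheses -/

section Condition

variable {X Y : Type*} [MulAction G X] [MulAction G Y] {ρ : G}

/-- **Symmetry.**  If every pair `(x, y)` admits `g` with `g x = ρ x`, `g y = y`, then every pair admits `g'` with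
`g' y = ρ y`, `g' x = x` — namely `g' = ρ g⁻¹` (`ρ` commuting with `G` on `X`, `ρ² = 1` on `X`).  In Galois terms
`ρ ∈ H_y H_x ⟺ ρ = ρ⁻¹ ∈ H_x H_y`. [cite: Serre1977, §7.3] -/
theorem pointwiseConj_symm (hcomm : ∀ (g : G) (x : X), g • ρ • x = ρ • g • x) (hinv : ∀ x : X, ρ • ρ • x = x)
    (h : ∀ (x : X) (y : Y), ∃ g : G, g • x = ρ • x ∧ g • y = y) :
    ∀ (y : Y) (x : X), ∃ g : G, g • y = ρ • y ∧ g • x = x := by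
  intro y x
  obtain ⟨g, hgx, hgy⟩ := h x y
  refine ⟨ρ * g⁻¹, ?_, ?_⟩
  · rw [mul_smul, inv_smul_eq_iff.2 hgy.symm]
  · have h1 : g⁻¹ • x = ρ • x := by
      have h2 : x = g⁻¹ • ρ • x := (inv_smul_eq_iff.2 hgx.symm).symm
      rw [hcomm] at h2
      calc g⁻¹ • x = ρ • ρ • g⁻¹ • x := (hinv _).symm
        _ = ρ • x := by rw [← h2]
    rw [mul_smul, h1, hinv]

/-- **One base point suffices on a transitive slot.**  If `G` is transitive on `Y` and every `x ∈ X` admits `g` with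
`g x = ρ x`, `g y₀ = y₀`, then every pair `(x, y)` admits such a `g` (conjugate by `h` with `h y₀ = y`).
[cite: Serre1977, §7.3] -/
theorem pointwiseConj_of_basePoint (hcomm : ∀ (g : G) (x : X), g • ρ • x = ρ • g • x) {y₀ : Y}
    (htrans : ∀ y : Y, ∃ g : G, g • y₀ = y) (h : ∀ x : X, ∃ g : G, g • x = ρ • x ∧ g • y₀ = y₀) :
    ∀ (x : X) (y : Y), ∃ g : G, g • x = ρ • x ∧ g • y = y := by
  intro x y
  obtain ⟨k, rfl⟩ := htrans y
  obtain ⟨g, hgx, hgy⟩ := h (k⁻¹ • x)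
  refine ⟨k * g * k⁻¹, ?_, ?_⟩
  · rw [mul_smul, mul_smul, hgx, hcomm, smul_inv_smul]
  · rw [mul_smul, mul_smul, inv_smul_smul, hgy]

/-- The ONE-CONJUGATE hypothesis of `pairwise_of_rho_on_slot_of_smul_eq` (`σ = ρ` on all of `X`, `σ y₀ = y₀`, `G`
transitive on `Y`) implies the pointwise condition (the same `σ` serves every `x`). [cite: Gordon1999HodgeAVSurvey, §3 Theorem (proof)] -/
theorem pointwiseConj_of_rho_on_slot_of_smul_eq (hcomm : ∀ (g : G) (x : X), g • ρ • x = ρ • g • x) {σ : G}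
    (hσX : ∀ x : X, σ • x = ρ • x) {y₀ : Y} (hσy : σ • y₀ = y₀) (htrans : ∀ y : Y, ∃ g : G, g • y₀ = y) :
    ∀ (x : X) (y : Y), ∃ g : G, g • x = ρ • x ∧ g • y = y :=
  pointwiseConj_of_basePoint hcomm htrans fun x => ⟨σ, hσX x, hσy⟩

/-- The PARTIAL-CONJUGATION hypothesis of `pairwise_of_partialConj` (`σ = ρ` on `X`, `σ = 1` on `Y`) implies the
pointwise condition. [cite: Gordon1999HodgeAVSurvey, §3 Theorem (proof)] -/
theorem pointwiseConj_of_partialConj {σ : G} (hσX : ∀ x : X, σ • x = ρ • x) (hσY : ∀ y : Y, σ • y = y) :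
    ∀ (x : X) (y : Y), ∃ g : G, g • x = ρ • x ∧ g • y = y :=
  fun x y => ⟨σ, hσX x, hσY y⟩

end Condition

/-! ### §2 The core: under the pointwise condition every equivariant `T` on a stable `P ≤ Anti(X)` vanishes -/

section Core

variable {X Y : Type*} [MulAction G X] [MulAction G Y] [Fintype X] [DecidableEq X] {ρ : G}

omit [Fintype X] in
/-- Precomposing an elementary vector with `g`: `δ_x ∘ g = δ_{g⁻¹x}`. [cite: Gordon1999HodgeAVSurvey, §3 Theorem (proof)] -/
private theorem single_comp_smul (x : X) (g : G) :
    (fun z => (Pi.single x (1 : ℚ) : X → ℚ) (g • z)) = Pi.single (g⁻¹ • x) 1 := by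
  funext z
  simp only [Pi.single_apply, smul_eq_iff_eq_inv_smul]

/-- A weight is the combination of the elementary vectors with its values. [cite: Gordon1999HodgeAVSurvey, §3 Theorem (proof)] -/
private theorem eq_sum_smul_single (f : X → ℚ) : f = ∑ x, f x • (Pi.single x (1 : ℚ) : X → ℚ) := by
  funext z
  simp only [Finset.sum_apply, Pi.smul_apply, Pi.single_apply, smul_eq_mul, mul_ite, mul_one, mul_zero,
    Finset.sum_ite_eq, Finset.mem_univ, if_true]

/-- **Core lemma.**  Under the pointwise condition (`∀ x y ∃ g, g x = ρ x ∧ g y = y`), a linear `T : ℚ^X → ℚ^Y`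
which is equivariant on a `G`-stable `P` contained in the `ρ`-odd weights VANISHES on `P`.  (Project equivariantly
onto `P`, so that `T' = T ∘ π` is equivariant everywhere; its kernel `k(x, y) = T'(δ_x)(y)` is `G`-invariant, hence
`k(ρx, y) = k(x, y)`; then `Σ_x f(x) k(x, y)` changes sign under `x ↦ ρx` for odd `f`.)
[cite: Serre1977, §7.3–7.4] [cite: Gordon1999HodgeAVSurvey, §3 Theorem (proof)] -/
theorem apply_eq_zero_of_pointwiseConj (hpt : ∀ (x : X) (y : Y), ∃ g : G, g • x = ρ • x ∧ g • y = y)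
    {P : Submodule ℚ (X → ℚ)} (hPA : P ≤ antiWeights (E := X) ρ)
    (hPst : ∀ g : G, ∀ f ∈ P, (fun x => f (g • x)) ∈ P)
    (T : (X → ℚ) →ₗ[ℚ] (Y → ℚ)) (hT : ∀ g : G, ∀ f ∈ P, T (fun x => f (g • x)) = fun y => T f (g • y))
    {f : X → ℚ} (hf : f ∈ P) : T f = 0 := by
  obtain ⟨π, hπP, hπid, hπeq⟩ := exists_equivariant_proj (G := G) P hPst
  -- `T' = T ∘ π` is equivariant on all of `ℚ^X`
  set T' : (X → ℚ) →ₗ[ℚ] (Y → ℚ) := T ∘ₗ π with hT'_def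
  have hT'eq : ∀ (g : G) (u : X → ℚ), T' (fun x => u (g • x)) = fun y => T' u (g • y) := by
    intro g u
    change T (π (fun x => u (g • x))) = fun y => T (π u) (g • y)
    rw [hπeq g u]
    exact hT g (π u) (hπP u)
  -- the kernel and its invariance `k (g⁻¹ x) y = k x (g y)`
  set k : X → Y → ℚ := fun x y => T' (Pi.single x 1) y with hk_def
  have hk : ∀ (g : G) (x : X) (y : Y), k (g⁻¹ • x) y = k x (g • y) := by
    intro g x y
    have h1 := hT'eq g (Pi.single x 1)
    rw [single_comp_smul] at h1
    exact congrFun h1 y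
  -- `k (ρ x) y = k x y` from the pointwise element
  have hkρ : ∀ (x : X) (y : Y), k (ρ • x) y = k x y := by
    intro x y
    obtain ⟨g, hgx, hgy⟩ := hpt x y
    have h1 := hk g (ρ • x) y
    rw [← hgx, inv_smul_smul, hgy] at h1
    rw [← hgx]
    exact h1.symm
  -- `T f = T' f = Σ_x f x • T'(δ_x)`
  have hTf : T f = T' f := by
    change T f = T (π f)
    rw [hπid f hf]
  have hodd : ∀ x, f (ρ • x) = -f x := fun x => (mem_antiWeights_iff'.1 (hPA hf)) x
  rw [hTf]
  funext y
  have hexp : T' f y = ∑ x, f x * k x y := by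
    conv_lhs => rw [eq_sum_smul_single f]
    rw [map_sum, Finset.sum_apply]
    refine Finset.sum_congr rfl fun x _ => ?_
    rw [map_smul, Pi.smul_apply, smul_eq_mul]
  -- the sum changes sign under the reindexing `x ↦ ρ x`
  have hreindex : ∑ x, f x * k x y = ∑ x, f (ρ • x) * k (ρ • x) y :=
    (Fintype.sum_equiv (MulAction.toPerm ρ) (fun x => f (ρ • x) * k (ρ • x) y) (fun x => f x * k x y)
      fun _ => rfl).symm
  have hneg : ∑ x, f (ρ • x) * k (ρ • x) y = -∑ x, f x * k x y := by
    rw [← Finset.sum_neg_distrib]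
    refine Finset.sum_congr rfl fun x _ => ?_
    rw [hodd, hkρ, neg_mul]
  rw [Pi.zero_apply, hexp]
  linarith [hreindex.trans hneg]

/-- **Core lemma, subspace form**: under the pointwise condition a `G`-stable `P` inside the odd weights of `X` carrying
a `T : ℚ^X → ℚ^Y` equivariant and injective on `P` is zero (no condition on the values of `T`).
[cite: Serre1977, §7.3–7.4] [cite: Gordon1999HodgeAVSurvey, §3 Theorem (proof)] -/
theorem eq_bot_of_pointwiseConj (hpt : ∀ (x : X) (y : Y), ∃ g : G, g • x = ρ • x ∧ g • y = y)
    {P : Submodule ℚ (X → ℚ)} (hPA : P ≤ antiWeights (E := X) ρ)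
    (hPst : ∀ g : G, ∀ f ∈ P, (fun x => f (g • x)) ∈ P)
    (T : (X → ℚ) →ₗ[ℚ] (Y → ℚ)) (hT : ∀ g : G, ∀ f ∈ P, T (fun x => f (g • x)) = fun y => T f (g • y))
    (hTinj : ∀ f ∈ P, T f = 0 → f = 0) : P = ⊥ :=
  (Submodule.eq_bot_iff P).2 fun f hf => hTinj f hf (apply_eq_zero_of_pointwiseConj hpt hPA hPst T hT hf)

end Core

/-! ### §3 The theorem: pointwise partial conjugations exclude common constituents, in both orders, for all types -/

section Pairwise

variable {I : Type*} {E : I → Type*} [∀ i, MulAction G (E i)]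

/-- **Pointwise partial conjugations exclude common constituents (both orders).**  If `Φ_i ⊆ E_i` are CM types for
`ρ` and for every pair `(x, y) ∈ E_i × E_j` some `g ∈ G` has `g x = ρ x` and `g y = y`, then the slots `i`, `j` have no
common constituent in the sense of `map_slotExt_antiSpan_le_of_pairwise` (hypothesis shape `hpair`), in both orders:
every `G`-stable `P ≤ U(Φ_i)` with a `T` equivariant and injective on `P` into `U(Φ_j)` is zero, and vice versa.
Contains `pairwise_of_partialConj` and `pairwise_of_rho_on_slot_of_smul_eq` (§1).
[cite: Gordon1999HodgeAVSurvey, §3 Theorem (proof)] [cite: Serre1977, §7.3–7.4] -/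
theorem pairwise_of_pointwiseConj {ρ : G} {Φ : ∀ i, Set (E i)} (h : ∀ i, IsCMTypeWith ρ (Φ i)) {i j : I}
    [Fintype (E i)] [Fintype (E j)] [DecidableEq (E i)] [DecidableEq (E j)]
    (hpt : ∀ (x : E i) (y : E j), ∃ g : G, g • x = ρ • x ∧ g • y = y) :
    (∀ P : Submodule ℚ (E i → ℚ), P ≤ antiSpan G (Φ i) →
      (∀ g : G, ∀ f ∈ P, (fun x => f (g • x)) ∈ P) →
      ∀ T : (E i → ℚ) →ₗ[ℚ] (E j → ℚ),
        (∀ g : G, ∀ f ∈ P, T (fun x => f (g • x)) = fun y => T f (g • y)) →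
        (∀ f ∈ P, T f ∈ antiSpan G (Φ j)) → (∀ f ∈ P, T f = 0 → f = 0) → P = ⊥) ∧
    (∀ P : Submodule ℚ (E j → ℚ), P ≤ antiSpan G (Φ j) →
      (∀ g : G, ∀ f ∈ P, (fun x => f (g • x)) ∈ P) →
      ∀ T : (E j → ℚ) →ₗ[ℚ] (E i → ℚ),
        (∀ g : G, ∀ f ∈ P, T (fun x => f (g • x)) = fun y => T f (g • y)) →
        (∀ f ∈ P, T f ∈ antiSpan G (Φ i)) → (∀ f ∈ P, T f = 0 → f = 0) → P = ⊥) := by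
  constructor
  · intro P hPU hPst T hT _ hTinj
    exact eq_bot_of_pointwiseConj hpt (hPU.trans (antiSpan_le_antiWeights' (h i))) hPst T hT hTinj
  · intro P hPU hPst T hT _ hTinj
    exact eq_bot_of_pointwiseConj (pointwiseConj_symm (h i).comm (h i).invol hpt)
      (hPU.trans (antiSpan_le_antiWeights' (h j))) hPst T hT hTinj

/-- **The same from one base point** of a transitive slot `E_j`: `∀ x ∃ g, g x = ρ x ∧ g y₀ = y₀`.
[cite: Gordon1999HodgeAVSurvey, §3 Theorem (proof)] [cite: Serre1977, §7.3–7.4] -/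
theorem pairwise_of_pointwiseConj_basePoint {ρ : G} {Φ : ∀ i, Set (E i)} (h : ∀ i, IsCMTypeWith ρ (Φ i)) {i j : I}
    [Fintype (E i)] [Fintype (E j)] [DecidableEq (E i)] [DecidableEq (E j)] {y₀ : E j}
    (htrans : ∀ y : E j, ∃ g : G, g • y₀ = y) (hpt : ∀ x : E i, ∃ g : G, g • x = ρ • x ∧ g • y₀ = y₀) :
    (∀ P : Submodule ℚ (E i → ℚ), P ≤ antiSpan G (Φ i) →
      (∀ g : G, ∀ f ∈ P, (fun x => f (g • x)) ∈ P) →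
      ∀ T : (E i → ℚ) →ₗ[ℚ] (E j → ℚ),
        (∀ g : G, ∀ f ∈ P, T (fun x => f (g • x)) = fun y => T f (g • y)) →
        (∀ f ∈ P, T f ∈ antiSpan G (Φ j)) → (∀ f ∈ P, T f = 0 → f = 0) → P = ⊥) ∧
    (∀ P : Submodule ℚ (E j → ℚ), P ≤ antiSpan G (Φ j) →
      (∀ g : G, ∀ f ∈ P, (fun x => f (g • x)) ∈ P) →
      ∀ T : (E j → ℚ) →ₗ[ℚ] (E i → ℚ),
        (∀ g : G, ∀ f ∈ P, T (fun x => f (g • x)) = fun y => T f (g • y)) →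
        (∀ f ∈ P, T f ∈ antiSpan G (Φ i)) → (∀ f ∈ P, T f = 0 → f = 0) → P = ⊥) :=
  pairwise_of_pointwiseConj h (pointwiseConj_of_basePoint (h i).comm htrans hpt)

end Pairwise

end PointwiseConj

end Literature.NumberTheory.ComplexMultiplication.PointwiseConjugation

end
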